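import Literature.Computability.Complexity.RandomizingPolynomialsMatrix
import HarnessLib

/-!
# Randomizing polynomials II: canonical form of the path matrix and the three encoding properties

Continues `RandomizingPolynomialsMatrix.lean` (the Ishai–Kushilevitz matrix randomization
`R₁ · L(x, ρ) · R₂` over `F₂` of the path branching program for `x₀ ⋯ x_d + ρ`).  Proved here:

* explicit elimination `pathMat xs ρ * elimB xs = elimAinv xs * canon (pathVal xs ρ)`
  (`pathMat_mul_elimB`) and `elimAinv xs * elimA xs = 1`, whence the canonical form
  `L(x, ρ) = A₀(x)⁻¹ · C_{f(x,ρ)} · B₀(x)` (`pathMat_eq`) with `f(x, ρ) = ∏ xᵢ + ρ`;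
* UNIQUENESS of the canonical form: the entries on and above the diagonal of `A · C_δ · B`
  (`A` upper unitriangular, `B` last-column) determine `A`, `B`, `δ` (`eq_of_proj_canon_eq`: the
  first `d` columns are the columns `1..d` of `A`; the last column is `A · (δ, B₀ₗ, …)`, cancel `A`);
* the three properties that make `(R₁, R₂) ↦ proj (R₁ · L · R₂)` a PERFECT randomized encoding of
  `f` [Ishai–Kushilevitz 2002, §3; Applebaum–Ishai–Kushilevitz 2006, §4]: it is injective for fixed
  `L` (`eq_of_proj_pathMat_eq`), its value determines `f` (`pathVal_eq_of_proj_eq`), and its range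
  depends only on `f` (`exists_proj_pathMat_eq`).

## References

* Y. Ishai, E. Kushilevitz, *Perfect constant-round secure computation via perfect randomizing
  polynomials*, ICALP 2002, §3.
* B. Applebaum, Y. Ishai, E. Kushilevitz, *Cryptography in NC⁰*, SIAM J. Comput. 36 (2006), §4.
* Z. Dvir, D. Gutfreund, G. N. Rothblum, S. Vadhan, *On approximating the entropy of polynomial
  mappings*, ECCC TR10-160 (2010), Thm 4.5 / Claim 4.4 (degree reduction for `PEA`).
-/

namespace Literature.Computability.Complexity

namespace RandPoly

open Matrix Finset

variable {d : ℕ}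

/-! ### Explicit elimination of the path matrix -/

/-- Entries of the canonical form. [folklore] -/
theorem canon_apply (δ : ZMod 2) (j k : Fin (d + 1)) :
    canon δ j k = (if j.val = k.val + 1 then 1 else 0) + (if j = 0 ∧ k = Fin.last d then δ else 0) := by
  simp [canon, pathMat]

/-- Last column of `B₀(x)`. [folklore] -/
theorem elimB_apply_last (xs : Fin (d + 1) → ZMod 2) (i : Fin (d + 1)) :
    elimB xs i (Fin.last d) = ∏ l ∈ Ico (i.val + 1) (d + 1), ext xs l := by
  simp [elimB]

/-- Other columns of `B₀(x)`. [folklore] -/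
theorem elimB_apply_ne (xs : Fin (d + 1) → ZMod 2) (i : Fin (d + 1)) {k : Fin (d + 1)}
    (hk : k ≠ Fin.last d) : elimB xs i k = if i = k then 1 else 0 := by
  simp [elimB, hk]

/-- The full product of the coordinates as an interval product. [folklore] -/
theorem prod_Ico_ext (xs : Fin (d + 1) → ZMod 2) : ∏ l ∈ Ico 0 (d + 1), ext xs l = ∏ i, xs i := by
  rw [← Finset.range_eq_Ico, Finset.prod_range]
  refine Finset.prod_congr rfl fun i _ => ?_
  simp [ext, i.isLt]

/-- Peeling the first factor off an interval product of coordinates. [folklore] -/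
theorem mul_prod_Ico_ext (xs : Fin (d + 1) → ZMod 2) (i : Fin (d + 1)) (m : ℕ) (hm : i.val < m) :
    xs i * ∏ l ∈ Ico (i.val + 1) m, ext xs l = ∏ l ∈ Ico i.val m, ext xs l := by
  rw [Finset.prod_eq_prod_Ico_succ_bot hm]
  congr 1
  simp [ext, i.isLt]

/-- **`A₀(x)⁻¹ · A₀(x) = 1`.** [cite: IshaiKushilevitz2002, §3] -/
theorem elimAinv_mul_elimA (xs : Fin (d + 1) → ZMod 2) : elimAinv xs * elimA xs = 1 := by
  ext i k
  rw [elimAinv_mul_apply, Matrix.one_apply]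
  simp only [elimA, of_apply]
  rcases lt_trichotomy i k with hik | rfl | hki
  · have hle : i ≤ k := le_of_lt hik
    have hlt : i.val < k.val := Fin.lt_def.1 hik
    have h1 : i.val + 1 < d + 1 := by have := k.isLt; omega
    have hle' : (⟨i.val + 1, h1⟩ : Fin (d + 1)) ≤ k := by rw [Fin.le_def]; exact hlt
    rw [if_pos hle, dif_pos h1, if_pos hle', if_neg (ne_of_lt hik)]
    rw [mul_prod_Ico_ext xs i k.val hlt, CharTwo.add_self_eq_zero]
  · rw [if_pos le_rfl, Finset.Ico_self, Finset.prod_empty, if_pos rfl]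
    split_ifs with h1 h2
    · exfalso; rw [Fin.le_def] at h2; simp at h2
    · rw [mul_zero, add_zero]
    · rw [add_zero]
  · rw [if_neg (not_le.2 hki), if_neg (Ne.symm (ne_of_lt hki)), zero_add]
    split_ifs with h1 h2
    · exfalso; rw [Fin.le_def] at h2; rw [Fin.lt_def] at hki; simp at h2; omega
    · rw [mul_zero]
    · rfl

/-- Rows `i + 1` of the canonical form. [folklore] -/
theorem canon_apply_succ (δ : ZMod 2) (i k : Fin (d + 1)) (h : i.val + 1 < d + 1) :
    canon δ ⟨i.val + 1, h⟩ k = if i = k then 1 else 0 := by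
  rw [canon_apply]
  have h0 : (⟨i.val + 1, h⟩ : Fin (d + 1)) ≠ 0 := fun h' => by
    have := congrArg Fin.val h'; simp at this
  simp only [h0, false_and, if_false, add_zero, Fin.ext_iff]
  by_cases hik : i.val = k.val
  · simp [hik]
  · rw [if_neg (by omega), if_neg hik]

/-- The correction term of `A₀(x)⁻¹ · C`. [folklore] -/
theorem elimAinv_canon_term (xs : Fin (d + 1) → ZMod 2) (δ : ZMod 2) (i k : Fin (d + 1)) :
    (if h : i.val + 1 < d + 1 then xs i * canon δ ⟨i.val + 1, h⟩ k else 0) =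
      if i = k ∧ k ≠ Fin.last d then xs i else 0 := by
  by_cases h : i.val + 1 < d + 1
  · rw [dif_pos h, canon_apply_succ]
    by_cases hik : i = k
    · subst hik
      have : i ≠ Fin.last d := fun h' => by rw [h', Fin.val_last] at h; omega
      simp [this]
    · simp [hik]
  · rw [dif_neg h]
    have hi : i = Fin.last d := Fin.ext (by rw [Fin.val_last]; have := i.isLt; omega)
    by_cases hik : i = k
    · subst hik; simp [hi]
    · simp [hik]

/-- **Explicit elimination**: `L(x, ρ) · B₀(x) = A₀(x)⁻¹ · C_{f(x, ρ)}` with `f(x, ρ) = ∏ xᵢ + ρ`.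
[cite: IshaiKushilevitz2002, §3] -/
theorem pathMat_mul_elimB (xs : Fin (d + 1) → ZMod 2) (ρ : ZMod 2) :
    pathMat xs ρ * elimB xs = elimAinv xs * canon (pathVal xs ρ) := by
  ext i k
  rw [pathMat_mul_apply, elimAinv_mul_apply, elimAinv_canon_term, canon_apply]
  by_cases hk : k = Fin.last d
  · -- last column: both sides are `[i = 0] · f`
    subst hk
    simp only [elimB_apply_last, Fin.val_last, and_true, ne_eq, not_true_eq_false, and_false,
      if_false, add_zero]
    have hi1 : ¬ i.val = d + 1 := by have := i.isLt; omega
    rw [if_neg hi1, zero_add, mul_prod_Ico_ext xs i (d + 1) i.isLt]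
    by_cases hi0 : i = 0
    · subst hi0
      rw [dif_neg (by simp), add_zero, if_pos rfl, if_pos rfl, Finset.Ico_self, Finset.prod_empty,
        mul_one, Fin.val_zero, prod_Ico_ext, pathVal]
    · have hpos : 0 < i.val := Nat.pos_of_ne_zero fun h => hi0 (Fin.ext h)
      rw [dif_pos hpos, if_neg hi0, if_neg hi0, add_zero]
      have : (⟨i.val - 1, by omega⟩ : Fin (d + 1)).val + 1 = i.val := by simp; omega
      rw [this, CharTwo.add_self_eq_zero]
  · -- other columns
    have hk' : Fin.last d ≠ k := fun h => hk h.symm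
    simp only [elimB_apply_ne xs _ hk, hk, hk', and_false, if_false, add_zero, ne_eq, not_false_eq_true,
      and_true, mul_zero, ite_self]
    by_cases hik : i = k
    · subst hik
      rw [if_pos rfl, if_pos rfl, mul_one]
      have hne : ¬ i.val = i.val + 1 := by omega
      rw [if_neg hne, zero_add]
      have hmid : (if h : 0 < i.val then (if (⟨i.val - 1, by omega⟩ : Fin (d + 1)) = i then (1 : ZMod 2)
          else 0) else 0) = 0 := by
        split_ifs with h1 h2
        · exfalso; have := congrArg Fin.val h2; simp at this; omega
        · rfl
        · rfl
      rw [hmid, add_zero]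
    · rw [if_neg hik, if_neg hik, mul_zero, zero_add, add_zero]
      by_cases hi : i.val = k.val + 1
      · rw [if_pos hi, dif_pos (by omega)]
        have hk' : (⟨i.val - 1, by omega⟩ : Fin (d + 1)) = k := Fin.ext (by simp; omega)
        rw [hk', if_pos rfl]
      · rw [if_neg hi]
        split_ifs with h1 h2
        · exfalso; apply hi; have := congrArg Fin.val h2; simp at this; omega
        · rfl
        · rfl

/-- **The path matrix in canonical form**: `L(x, ρ) = A₀(x)⁻¹ · C_{f(x,ρ)} · B₀(x)`.
[cite: IshaiKushilevitz2002, §3] -/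
theorem pathMat_eq (xs : Fin (d + 1) → ZMod 2) (ρ : ZMod 2) :
    pathMat xs ρ = elimAinv xs * canon (pathVal xs ρ) * elimB xs := by
  rw [← pathMat_mul_elimB, Matrix.mul_assoc, (elimB_isLastCol xs).mul_self, Matrix.mul_one]

/-! ### Uniqueness of the canonical form -/

/-- Columns other than the last of `M · C_δ` are the shifted columns of `M`. [folklore] -/
theorem mul_canon_apply_ne (M : Mat d) (δ : ZMod 2) (i : Fin (d + 1)) {k : Fin (d + 1)}
    (hk : k ≠ Fin.last d) :
    (M * canon (d := d) δ) i k = M i ⟨k.val + 1, by have := Fin.val_lt_last hk; omega⟩ := by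
  rw [canon, mul_pathMat_apply, dif_pos (by have := Fin.val_lt_last hk; omega), if_neg hk]
  simp

/-- The last column of `C_δ · B` for a last-column matrix `B`: `(δ, B₀ₗ, B₁ₗ, …)`. [folklore] -/
theorem canon_mul_apply_last {B : Mat d} (hB : IsLastCol B) (δ : ZMod 2) (j : Fin (d + 1)) :
    (canon (d := d) δ * B) j (Fin.last d) =
      (if h : 0 < j.val then B ⟨j.val - 1, by omega⟩ (Fin.last d) else 0) + (if j = 0 then δ else 0) := by
  rw [canon, pathMat_mul_apply, hB.1]
  simp

/-- Uniqueness of the canonical form, unitriangular part: the columns before the last of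
`A · C_δ · B` are the columns `1, …, d` of `A`. [cite: IshaiKushilevitz2002, §3] -/
theorem unitri_eq_of_proj_canon_eq {A A' B B' : Mat d} (hA : IsUnitri A) (hA' : IsUnitri A')
    (hB : IsLastCol B) (hB' : IsLastCol B') {δ δ' : ZMod 2}
    (h : ∀ i k : Fin (d + 1), i ≤ k → (A * canon (d := d) δ * B) i k = (A' * canon (d := d) δ' * B') i k) :
    A = A' := by
  ext i j
  by_cases hj : j = 0
  · rw [hj, hA.apply_zero, hA'.apply_zero]
  rcases lt_trichotomy i j with hij | rfl | hji
  · have hjpos : 0 < j.val := Nat.pos_of_ne_zero fun h' => hj (Fin.ext h')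
    have hjd : j.val < d + 1 := j.isLt
    let k : Fin (d + 1) := ⟨j.val - 1, by omega⟩
    have hkv : k.val = j.val - 1 := rfl
    have hkl : k ≠ Fin.last d := fun h' => by
      have h2 := congrArg Fin.val h'; rw [hkv, Fin.val_last] at h2; omega
    have hik : i ≤ k := by rw [Fin.le_def, hkv]; rw [Fin.lt_def] at hij; omega
    have hjk : (⟨k.val + 1, by have := Fin.val_lt_last hkl; omega⟩ : Fin (d + 1)) = j :=
      Fin.ext (by simp only [hkv]; omega)
    have h1 := h i k hik
    rw [mul_lastCol_apply hB, mul_lastCol_apply hB', if_neg hkl, if_neg hkl,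
      mul_canon_apply_ne A δ i hkl, mul_canon_apply_ne A' δ' i hkl, hjk] at h1
    exact h1
  · rw [hA.1, hA'.1]
  · rw [hA.2 i j hji, hA'.2 i j hji]

/-- Uniqueness of the canonical form, last column: with the same `A`, the last columns of
`C_δ · B` and `C_δ' · B'` agree (cancel the invertible `A`). [cite: IshaiKushilevitz2002, §3] -/
theorem lastCol_eq_of_proj_canon_eq {A B B' : Mat d} (hA : IsUnitri A)
    {δ δ' : ZMod 2}
    (h : ∀ i k : Fin (d + 1), i ≤ k → (A * canon (d := d) δ * B) i k = (A * canon (d := d) δ' * B') i k)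
    (j : Fin (d + 1)) :
    (canon (d := d) δ * B) j (Fin.last d) = (canon (d := d) δ' * B') j (Fin.last d) := by
  set w : Fin (d + 1) → ZMod 2 := fun j => (canon (d := d) δ * B) j (Fin.last d) with hw
  set w' : Fin (d + 1) → ZMod 2 := fun j => (canon (d := d) δ' * B') j (Fin.last d) with hw'
  have hmv : A *ᵥ w = A *ᵥ w' := by
    funext i
    have h1 := h i (Fin.last d) (Fin.le_last i)
    rw [Matrix.mul_assoc, Matrix.mul_assoc, mul_apply, mul_apply] at h1
    simp only [mulVec, dotProduct]
    exact h1
  -- cancel the unit `A` (without the `Field`-level injectivity lemma)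
  obtain ⟨u, hu⟩ := hA.isUnit
  have hww : w = w' := by
    have key : ∀ v : Fin (d + 1) → ZMod 2, v = (↑u⁻¹ : Mat d) *ᵥ (A *ᵥ v) := fun v => by
      rw [Matrix.mulVec_mulVec, ← hu, Units.inv_mul, Matrix.one_mulVec]
    rw [key w, key w', hmv]
  exact congrFun hww j

/-- In a monoid, a one-sided inverse of a unit is two-sided. [folklore] -/
theorem mul_eq_one_comm_of_isUnit {M : Type*} [Monoid M] {a b : M} (ha : IsUnit a) (h : a * b = 1) :
    b * a = 1 := by
  obtain ⟨u, rfl⟩ := ha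
  have hb : b = ↑u⁻¹ := by
    calc b = ↑u⁻¹ * (↑u * b) := by rw [← mul_assoc, Units.inv_mul, one_mul]
      _ = ↑u⁻¹ := by rw [h, mul_one]
  rw [hb, Units.inv_mul]

/-- **Uniqueness of the canonical form**: the entries on and above the diagonal of `A · C_δ · B`
(`A` upper unitriangular, `B` last-column) determine `A`, `B` and `δ`. [cite: IshaiKushilevitz2002, §3] -/
theorem eq_of_proj_canon_eq {A A' B B' : Mat d} (hA : IsUnitri A) (hA' : IsUnitri A')
    (hB : IsLastCol B) (hB' : IsLastCol B') {δ δ' : ZMod 2}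
    (h : ∀ i k : Fin (d + 1), i ≤ k → (A * canon (d := d) δ * B) i k = (A' * canon (d := d) δ' * B') i k) :
    A = A' ∧ B = B' ∧ δ = δ' := by
  have hAA : A = A' := unitri_eq_of_proj_canon_eq hA hA' hB hB' h
  subst hAA
  have hw0 := lastCol_eq_of_proj_canon_eq hA h
  have hδ : δ = δ' := by
    have h0 := hw0 0
    rw [canon_mul_apply_last hB, canon_mul_apply_last hB'] at h0
    have hz : ¬ (0 < (0 : Fin (d + 1)).val) := by simp
    rw [dif_neg hz, dif_neg hz, if_pos rfl, if_pos rfl, zero_add, zero_add] at h0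
    exact h0
  refine ⟨rfl, ?_, hδ⟩
  ext l k
  by_cases hk : k = Fin.last d
  · subst hk
    by_cases hl : l = Fin.last d
    · rw [hl, hB.1, hB'.1]
    · have hl1 : l.val + 1 < d + 1 := by have := Fin.val_lt_last hl; omega
      have h1 := hw0 ⟨l.val + 1, hl1⟩
      have hne : (⟨l.val + 1, hl1⟩ : Fin (d + 1)) ≠ 0 := fun h' => by
        have h2 := congrArg Fin.val h'; simp at h2
      have hpos : 0 < (⟨l.val + 1, hl1⟩ : Fin (d + 1)).val := Nat.succ_pos _
      rw [canon_mul_apply_last hB, canon_mul_apply_last hB'] at h1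
      simp only [dif_pos hpos, if_neg hne, add_zero] at h1
      have hll : (⟨(⟨l.val + 1, hl1⟩ : Fin (d + 1)).val - 1, by simp; omega⟩ : Fin (d + 1)) = l :=
        Fin.ext (by simp)
      rw [hll] at h1
      exact h1
  · by_cases hlk : l = k
    · subst hlk; rw [hB.1, hB'.1]
    · rw [hB.2 l k hlk hk, hB'.2 l k hlk hk]

/-! ### The three properties of the randomization `(A, B) ↦ proj (A · L · B)` -/

/-- **Injectivity**: for a fixed path matrix, the projection of `A · L(x,ρ) · B` determines the
randomizers `A`, `B`. [cite: IshaiKushilevitz2002, §3] -/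
theorem eq_of_proj_pathMat_eq {xs : Fin (d + 1) → ZMod 2} {ρ : ZMod 2} {A A' B B' : Mat d}
    (hA : IsUnitri A) (hA' : IsUnitri A') (hB : IsLastCol B) (hB' : IsLastCol B')
    (h : ∀ i k : Fin (d + 1), i ≤ k → (A * pathMat xs ρ * B) i k = (A' * pathMat xs ρ * B') i k) :
    A = A' ∧ B = B' := by
  have key : ∀ (A B : Mat d), A * pathMat xs ρ * B =
      (A * elimAinv xs) * canon (pathVal xs ρ) * (elimB xs * B) := fun A B => by
    rw [pathMat_eq]; simp only [Matrix.mul_assoc]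
  simp only [key] at h
  obtain ⟨h1, h2, -⟩ := eq_of_proj_canon_eq (hA.mul (elimAinv_isUnitri xs))
    (hA'.mul (elimAinv_isUnitri xs)) ((elimB_isLastCol xs).mul hB) ((elimB_isLastCol xs).mul hB') h
  exact ⟨(elimAinv_isUnitri xs).isUnit.mul_right_cancel h1,
    (elimB_isLastCol xs).isUnitri.isUnit.mul_left_cancel h2⟩

/-- **Decodability**: the projection of `A · L(x,ρ) · B` determines the value `x₀ ⋯ x_d + ρ`.
[cite: IshaiKushilevitz2002, §3] -/
theorem pathVal_eq_of_proj_eq {xs xs' : Fin (d + 1) → ZMod 2} {ρ ρ' : ZMod 2} {A A' B B' : Mat d}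
    (hA : IsUnitri A) (hA' : IsUnitri A') (hB : IsLastCol B) (hB' : IsLastCol B')
    (h : ∀ i k : Fin (d + 1), i ≤ k → (A * pathMat xs ρ * B) i k = (A' * pathMat xs' ρ' * B') i k) :
    pathVal xs ρ = pathVal xs' ρ' := by
  have key : ∀ (xs : Fin (d + 1) → ZMod 2) (ρ : ZMod 2) (A B : Mat d), A * pathMat xs ρ * B =
      (A * elimAinv xs) * canon (pathVal xs ρ) * (elimB xs * B) := fun xs ρ A B => by
    rw [pathMat_eq]; simp only [Matrix.mul_assoc]
  simp only [key] at h
  exact (eq_of_proj_canon_eq (hA.mul (elimAinv_isUnitri xs)) (hA'.mul (elimAinv_isUnitri xs'))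
    ((elimB_isLastCol xs).mul hB) ((elimB_isLastCol xs').mul hB') h).2.2

/-- **Range**: if two path matrices compute the same value, every randomization of the first is a
randomization of the second (so the multiset `{proj (A · L · B)}` depends only on the value).
[cite: IshaiKushilevitz2002, §3] -/
theorem exists_proj_pathMat_eq {xs xs' : Fin (d + 1) → ZMod 2} {ρ ρ' : ZMod 2}
    (hv : pathVal xs ρ = pathVal xs' ρ') {A B : Mat d} (hA : IsUnitri A) (hB : IsLastCol B) :
    ∃ A' B' : Mat d, IsUnitri A' ∧ IsLastCol B' ∧ A' * pathMat xs' ρ' * B' = A * pathMat xs ρ * B := by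
  refine ⟨A * elimAinv xs * elimA xs', elimB xs' * elimB xs * B,
    (hA.mul (elimAinv_isUnitri xs)).mul (elimA_isUnitri xs'),
    ((elimB_isLastCol xs').mul (elimB_isLastCol xs)).mul hB, ?_⟩
  have e1 : elimA xs' * elimAinv xs' = 1 :=
    mul_eq_one_comm_of_isUnit (elimAinv_isUnitri xs').isUnit (elimAinv_mul_elimA xs')
  rw [pathMat_eq xs' ρ', pathMat_eq xs ρ, ← hv]
  simp only [Matrix.mul_assoc]
  rw [← Matrix.mul_assoc (elimA xs') (elimAinv xs') _, e1, Matrix.one_mul,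
    ← Matrix.mul_assoc (elimB xs') (elimB xs') _, (elimB_isLastCol xs').mul_self, Matrix.one_mul]

end RandPoly

end Literature.Computability.Complexity
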